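import Summits.CriticalPhenomena.PercolationContinuityZ3.Theorems.PercNearOneGluingNoHeavyQuantIndepBlobBigCarriers
import Summits.CriticalPhenomena.PercolationContinuityZ3.Theorems.PercNearOneGluingNoHeavyQuantIndepBlobTruncatedMean
import HarnessLib

/-!
# QUANT lane R8, Conjecture DIB\* — THREE PAIRWISE-GIANT LIGHTS (the pair-witness row): if three blobs below the floor complete the level in
# pairs and carry discounted credit rates `κ₁ + κ₂ + κ₃ > 2`, then `P(N ≥ j+1) ≥ x` — part (XV) of the cloud series

builds on p205010 (kernel theorem, internal audit signed; external expert review pending)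

Support file (`--supports stmt-CriticalPhenomena-4575`), QUANT lane census seat prim-quant-census-1 (gen 16), rung R8 of
`run/shared/lean/prim/quant/LADDER.md`; memo `run/shared/lean/prim/quant/prim-quant-census-1/TRUNCATED-MEAN-G16.md` §7/§9.  Theorems only,
no definitions, no sorries, standard axioms.

WHY.  The exact residual map of this seat (kit j131854: 3.1 M multi-light corner instances) leaves 1.2 % of instances outside every kernel
family and the Cantelli rule; they are clouds of a few big lights just below the floor with little heavy mass, where the light-cloud LP has
only deficient and giant atoms — no decomposition helps, a direct inequality is needed.  Its pure form: **(PW₃) three lights with gates `≤ x`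
and `κ_x(g₁) + κ_x(g₂) + κ_x(g₃) ≥ 2` have `P(at most one open) ≤ 1 − x`** (`1/2 ≤ x`; extremal `κ ≡ 2/3` at `x ≈ .69`, margin `.23(1−x)` = the
7/9 family).  PROOF: with `q = 1 − g ≥ 1 − x`, `s = Σq ≤ (1−x)(1+3x)`: `P(≤ 1 open) = e₂(q) − 2e₃(q) ≤ s²/3 − 2(1−x)²(s − 2(1−x)) ≤ 1 − x`
(`e₃ ≥ (1−x)²(s − 2(1−x))` by expanding `Π((1−x) + w_i)`, `s² ≤ s(1−x)(1+3x)`, and `27x³ − 45x² + 25x − 4 = ((9x−5)³ + 17)/27 > 0`).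
In a DIB\* instance any two of three PAIRWISE-GIANT lights (`a_i + a_k ≥ j+1`) complete the level, so `P(N ≥ j+1) ≥ P(≥ 2 of them open) ≥ x`
whatever the other blobs are (pw_cover.py: this certifies 616 of the 759 sampled residual instances; the rest are near-floor pure-light clouds =
the size row with slightly sub-floor gates, memo §9).

* `Quant.IndepBlob.pairWitness_three` — (PW₃) as a real inequality.
* **`Quant.IndepBlob.tail_ge_of_threePairGiants`** — gates in `[0,1]`, `1/2 ≤ x < 1`, three distinct blobs `ℓ₁ ℓ₂ ℓ₃` with gates `≤ x`,
  `a ℓ_i + a ℓ_k ≥ j+1` for the three pairs and `Σ_i (g ℓ_i − x²)/(1 − x) ≥ 2` ⟹ `x ≤ P(N ≥ j+1)` (all other blobs arbitrary).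

[this work; this lane's census]; the gluing rows served: [cite: KozmaNitzan2024, Conjecture 3 (p. 15)]; product weights
[cite: Grimmett1999, §1.3 p. 10].
-/

namespace Summit.CriticalPhenomena.PercolationContinuityZ3.Theorems

namespace Quant

namespace IndepBlob

open Finset

variable {κ : Type*} [DecidableEq κ]

/-- restricted product weight of the outcome `S` of the cloud `L` -/
local notation3 "wL[" p ", " L ", " S "]" =>
  ∏ k ∈ (L : Finset κ), (if k ∈ (S : Finset κ) then (p : κ → ℝ) k else 1 - (p : κ → ℝ) k)

/-! ### 26. The pair-witness inequality -/

/-- **(PW₃)**: `1/2 ≤ x < 1`, `q_i ≥ 1 − x` (`i = 1,2,3`) and `q₁ + q₂ + q₃ ≤ (1 − x)(1 + 3x)` (i.e. `Σ κ_x(1 − q_i) ≥ 2`) ⟹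
`q₁q₂ + q₁q₃ + q₂q₃ − 2q₁q₂q₃ ≤ 1 − x` (= `P(at most one of three lights open) ≤ 1 − x`). [this work] -/
theorem pairWitness_three (x q₁ q₂ q₃ : ℝ) (hx : 1 / 2 ≤ x) (hx1 : x < 1) (h₁ : 1 - x ≤ q₁) (h₂ : 1 - x ≤ q₂) (h₃ : 1 - x ≤ q₃)
    (hs : q₁ + q₂ + q₃ ≤ (1 - x) * (1 + 3 * x)) : q₁ * q₂ + q₁ * q₃ + q₂ * q₃ - 2 * (q₁ * q₂ * q₃) ≤ 1 - x := by
  have h1x : 0 < 1 - x := by linarith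
  set s := q₁ + q₂ + q₃ with hs_def
  -- `e₂ ≤ s²/3`
  have he2 : q₁ * q₂ + q₁ * q₃ + q₂ * q₃ ≤ s ^ 2 / 3 := by
    rw [hs_def]; nlinarith [sq_nonneg (q₁ - q₂), sq_nonneg (q₁ - q₃), sq_nonneg (q₂ - q₃)]
  -- `e₃ ≥ (1−x)²(s − 2(1−x))`: expand `Π((1−x) + w_i)` and drop the nonnegative higher terms
  have he3 : (1 - x) ^ 2 * (s - 2 * (1 - x)) ≤ q₁ * q₂ * q₃ := by
    have hw₁ : 0 ≤ q₁ - (1 - x) := by linarith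
    have hw₂ : 0 ≤ q₂ - (1 - x) := by linarith
    have hw₃ : 0 ≤ q₃ - (1 - x) := by linarith
    have e : q₁ * q₂ * q₃ - (1 - x) ^ 2 * (s - 2 * (1 - x)) =
        (1 - x) * ((q₁ - (1 - x)) * (q₂ - (1 - x)) + (q₁ - (1 - x)) * (q₃ - (1 - x)) + (q₂ - (1 - x)) * (q₃ - (1 - x))) +
          (q₁ - (1 - x)) * (q₂ - (1 - x)) * (q₃ - (1 - x)) := by rw [hs_def]; ring
    nlinarith [mul_nonneg hw₁ hw₂, mul_nonneg hw₁ hw₃, mul_nonneg hw₂ hw₃, mul_nonneg (mul_nonneg hw₁ hw₂) hw₃]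
  have hs0 : 0 ≤ s := by rw [hs_def]; linarith
  have hs3 : 3 * (1 - x) ≤ s := by rw [hs_def]; linarith
  -- `s² ≤ s·(1−x)(1+3x)`
  have hss : s ^ 2 ≤ s * ((1 - x) * (1 + 3 * x)) := by rw [sq]; exact mul_le_mul_of_nonneg_left hs hs0
  -- the cubic `27x³ − 45x² + 25x − 4 = ((9x − 5)³ + 17)/27 > 0` on `x ≥ 1/2`
  have hcubic : 0 ≤ 27 * x ^ 3 - 45 * x ^ 2 + 25 * x - 4 := by nlinarith [sq_nonneg (9 * x - 5), mul_nonneg (mul_nonneg (by linarith : (0:ℝ) ≤ 9 * x - 5 + 1/2 + 1/2 - 1 + 1) (sq_nonneg (9 * x - 5))) (le_refl 0), hx]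
  rcases le_or_gt (5 / 9 : ℝ) x with hx59 | hx59
  · -- `9x − 5 ≥ 0`: the bound increases in `s`, evaluate at `s = (1−x)(1+3x)`
    nlinarith [mul_le_mul_of_nonneg_left hs (show (0:ℝ) ≤ (1 - x) * (9 * x - 5) by nlinarith), h1x]
  · -- `9x − 5 < 0`: the bound decreases in `s`, evaluate at `s = 3(1−x)`
    nlinarith [mul_le_mul_of_nonneg_left hs3 (show (0:ℝ) ≤ (1 - x) * (5 - 9 * x) by nlinarith), h1x]

/-! ### 27. Three pairwise-giant lights -/

/-- Two-light evaluation: `Σ_{S ⊆ {i,k}} w(S)·[S ≠ ∅] = 1 − (1 − p i)(1 − p k)`. [folklore] -/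
theorem sum_pair_weight_nonempty (p : κ → ℝ) (i k : κ) (hik : i ≠ k) :
    ∑ S ∈ ({i, k} : Finset κ).powerset, wL[p, {i, k}, S] * (if S = ∅ then (0 : ℝ) else 1) = 1 - (1 - p i) * (1 - p k) := by
  have hi : i ∉ ({k} : Finset κ) := fun h => hik (Finset.mem_singleton.1 h)
  rw [show ({i, k} : Finset κ) = insert i {k} from rfl, sum_powerset_weight_insert p {k} i hi,
    sum_powerset_singleton_weight p k, sum_powerset_singleton_weight p k]
  simp only [Finset.insert_ne_empty, if_false, if_true, Finset.singleton_ne_empty]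
  ring

/-- Two-light evaluation: `Σ_{S ⊆ {i,k}} w(S)·[S = {i,k}] = p i · p k`. [folklore] -/
theorem sum_pair_weight_full (p : κ → ℝ) (i k : κ) (hik : i ≠ k) :
    ∑ S ∈ ({i, k} : Finset κ).powerset, wL[p, {i, k}, S] * (if 2 ≤ S.card then (1 : ℝ) else 0) = p i * p k := by
  have hi : i ∉ ({k} : Finset κ) := fun h => hik (Finset.mem_singleton.1 h)
  rw [show ({i, k} : Finset κ) = insert i {k} from rfl, sum_powerset_weight_insert p {k} i hi,
    sum_powerset_singleton_weight p k, sum_powerset_singleton_weight p k]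
  have c1 : (insert i (∅ : Finset κ)).card = 1 := by rw [Finset.insert_empty, Finset.card_singleton]
  have c2 : (insert i ({k} : Finset κ)).card = 2 := by rw [Finset.card_insert_of_notMem hi, Finset.card_singleton]
  simp only [c1, c2, Finset.card_empty, Finset.card_singleton, le_refl, if_true, if_false,
    show ¬ (2 ≤ 0) from by omega, show ¬ (2 ≤ 1) from by omega]
  ring

/-- **THE PAIR-WITNESS ROW (three pairwise-giant lights).**  All gates in `[0,1]`, floor `1/2 ≤ x < 1`; three distinct blobs `ℓ₁ ℓ₂ ℓ₃` with
gates `≤ x`, pairwise giant (`j+1 ≤ a ℓ_i + a ℓ_k`), and `(g ℓ₁ − x²)/(1−x) + (g ℓ₂ − x²)/(1−x) + (g ℓ₃ − x²)/(1−x) ≥ 2` ⟹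
`x ≤ P(Σ_{open} a ≥ j+1)`, whatever the other blobs are. [this work] -/
theorem tail_ge_of_threePairGiants [Fintype κ] (p : κ → ℝ) (a : κ → ℕ) (x : ℝ) (hx : 1 / 2 ≤ x) (hx1 : x < 1)
    (hp0 : ∀ k, 0 ≤ p k) (hp1 : ∀ k, p k ≤ 1) (j : ℕ) (ℓ₁ ℓ₂ ℓ₃ : κ) (h12 : ℓ₁ ≠ ℓ₂) (h13 : ℓ₁ ≠ ℓ₃) (h23 : ℓ₂ ≠ ℓ₃)
    (hg₁ : p ℓ₁ ≤ x) (hg₂ : p ℓ₂ ≤ x) (hg₃ : p ℓ₃ ≤ x)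
    (hpair12 : j + 1 ≤ a ℓ₁ + a ℓ₂) (hpair13 : j + 1 ≤ a ℓ₁ + a ℓ₃) (hpair23 : j + 1 ≤ a ℓ₂ + a ℓ₃)
    (hκ : 2 ≤ (p ℓ₁ - x ^ 2) / (1 - x) + (p ℓ₂ - x ^ 2) / (1 - x) + (p ℓ₃ - x ^ 2) / (1 - x)) :
    x ≤ ∑ W : Finset κ, (∏ k, if k ∈ W then p k else 1 - p k) * (if j + 1 ≤ ∑ k ∈ W, a k then (1 : ℝ) else 0) := by
  have h1x : 0 < 1 - x := by linarith
  set T : Finset κ := {ℓ₁, ℓ₂, ℓ₃} with hT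
  set F : Finset κ → ℝ := fun S => if 2 ≤ S.card then (1 : ℝ) else 0 with hF
  -- two of the three lights complete the level
  have hF_le : ∀ W : Finset κ, F (W ∩ T) ≤ (if j + 1 ≤ ∑ k ∈ W, a k then (1 : ℝ) else 0) := by
    intro W
    simp only [hF]
    split_ifs with hc hW
    · exact le_rfl
    · exfalso
      obtain ⟨u, hu, v, hv, huv⟩ := Finset.one_lt_card.1 (by omega : 1 < (W ∩ T).card)
      have huW : u ∈ W := (Finset.mem_inter.1 hu).1
      have hvW : v ∈ W := (Finset.mem_inter.1 hv).1
      have huT := (Finset.mem_inter.1 hu).2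
      have hvT := (Finset.mem_inter.1 hv).2
      have hsub : ({u, v} : Finset κ) ⊆ W := by
        intro y hy; rcases Finset.mem_insert.1 hy with h | h
        · rw [h]; exact huW
        · rw [Finset.mem_singleton.1 h]; exact hvW
      have hsum : a u + a v ≤ ∑ k ∈ W, a k := by
        have := Finset.sum_le_sum_of_subset_of_nonneg hsub (fun k _ _ => Nat.zero_le (a k))
        rwa [Finset.sum_pair huv] at this
      simp only [hT, Finset.mem_insert, Finset.mem_singleton] at huT hvT
      apply hW
      rcases huT with rfl | rfl | rfl <;> rcases hvT with rfl | rfl | rfl <;>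
        first | exact absurd rfl huv | omega
    · exact zero_le_one
    · exact le_rfl
  -- marginalise onto `T`
  have hmarg : ∑ W : Finset κ, (∏ k, if k ∈ W then p k else 1 - p k) * F (W ∩ T) =
      ∑ S ∈ T.powerset, wL[p, T, S] * F S := by
    have hdisj : Disjoint T (Finset.univ \ T) := Finset.disjoint_sdiff
    have hU : T ∪ (Finset.univ \ T) = Finset.univ := Finset.union_sdiff_of_subset (Finset.subset_univ T)
    have key := sum_powerset_weight_union_mul p T (Finset.univ \ T) hdisj F (fun _ => (1 : ℝ))
    rw [hU, Finset.powerset_univ] at key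
    simp only [mul_one, sum_powerset_weight] at key
    rw [← key]
  -- evaluate the three-light sum: `p₁(1 − q₂q₃) + q₁ p₂ p₃`
  have hℓ₁T₂ : ℓ₁ ∉ ({ℓ₂, ℓ₃} : Finset κ) := by simp [h12, h13]
  have hval : ∑ S ∈ T.powerset, wL[p, T, S] * F S =
      p ℓ₁ * (1 - (1 - p ℓ₂) * (1 - p ℓ₃)) + (1 - p ℓ₁) * (p ℓ₂ * p ℓ₃) := by
    rw [hT, sum_powerset_weight_insert p {ℓ₂, ℓ₃} ℓ₁ hℓ₁T₂]
    have e1 : ∀ S ∈ ({ℓ₂, ℓ₃} : Finset κ).powerset, wL[p, {ℓ₂, ℓ₃}, S] * F (insert ℓ₁ S) =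
        wL[p, {ℓ₂, ℓ₃}, S] * (if S = ∅ then (0 : ℝ) else 1) := by
      intro S hS
      have hℓ₁S : ℓ₁ ∉ S := fun h => hℓ₁T₂ (Finset.mem_powerset.1 hS h)
      simp only [hF, Finset.card_insert_of_notMem hℓ₁S]
      by_cases hS0 : S = ∅
      · simp [hS0]
      · have : 1 ≤ S.card := Finset.card_pos.2 (Finset.nonempty_iff_ne_empty.2 hS0)
        rw [if_pos (by omega), if_neg hS0]
    rw [Finset.sum_congr rfl e1, sum_pair_weight_nonempty p ℓ₂ ℓ₃ h23]
    simp only [hF]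
    rw [sum_pair_weight_full p ℓ₂ ℓ₃ h23]
  -- (PW₃)
  have hq : (1 - p ℓ₁) + (1 - p ℓ₂) + (1 - p ℓ₃) ≤ (1 - x) * (1 + 3 * x) := by
    have e : (p ℓ₁ - x ^ 2) / (1 - x) + (p ℓ₂ - x ^ 2) / (1 - x) + (p ℓ₃ - x ^ 2) / (1 - x) =
        (p ℓ₁ + p ℓ₂ + p ℓ₃ - 3 * x ^ 2) / (1 - x) := by field_simp; ring
    rw [e, le_div_iff₀ h1x] at hκ
    nlinarith
  have hpw := pairWitness_three x (1 - p ℓ₁) (1 - p ℓ₂) (1 - p ℓ₃) hx hx1 (by linarith) (by linarith) (by linarith) hq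
  calc x ≤ p ℓ₁ * (1 - (1 - p ℓ₂) * (1 - p ℓ₃)) + (1 - p ℓ₁) * (p ℓ₂ * p ℓ₃) := by nlinarith
    _ = ∑ W : Finset κ, (∏ k, if k ∈ W then p k else 1 - p k) * F (W ∩ T) := by rw [hmarg, hval]
    _ ≤ ∑ W : Finset κ, (∏ k, if k ∈ W then p k else 1 - p k) * (if j + 1 ≤ ∑ k ∈ W, a k then (1 : ℝ) else 0) :=
        Finset.sum_le_sum fun W _ => mul_le_mul_of_nonneg_left (hF_le W)
          (bernoulliWeight_nonneg hp0 hp1 W)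

end IndepBlob

end Quant

end Summit.CriticalPhenomena.PercolationContinuityZ3.Theorems
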